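import Summits.ValiantsHypothesis.ValiantsHypothesis.Theses.ScaledPencil
import Summits.ValiantsHypothesis.ValiantsHypothesis.Theses.DetQP
import Literature.Computability.AlgebraicComplexity.DeterminantalComplexityProofs

/-!
# Crux `DetqpSuperquadratic` (stmt-ValiantsHypothesis-0318) — line `scaled-pencil`, stub `stub_gaugeTransfer`

Registered line `Cruxes/DetqpSuperquadratic/Lines/scaled_pencil.lean` (tenure sweep g1 T3, director-valiant
g8 2026-08-27; registered by val-width-glueclose-p1, skeleton stubs `stub_scaledPencilSuperquadratic`
[load-bearing, open-problem grade] and `stub_gaugeTransfer` [provable now]). This file proves the GAUGE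
TRANSFER verbatim:

  `stub_gaugeTransfer : ScaledPencil.NormalForm → ScaledPencil.ScaledPencilSuperquadratic → DetQP.DetqpSuperquadratic`.

Proof (bookkeeping, S): given `ε > 0`, `n₀` from the normal-form-gauge bound and `n ≥ n₀`, take an affine
determinantal expression of `per_n` of the attained size `m = dc(per_n)`
(`hasDetRepr_determinantalComplexity_holds`), pass to a normal-form pencil `(Λ, L)` of size `m' ≤ m` by
`NormalForm` (stmt-5317 ✓, `Theorems.ScaledPencilNormalFormSplit.normalForm_proof`; exact identity
`det(Λ + L(x)) = per_n`, the doubly balanced `α`-bookkeeping, strict expansion of proper subspaces), and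
apply the gauge bound to it: `n^{2+ε} ≤ m' ≤ m = dc(per_n)`.

With the line's kernel-checked composition `DetqpSuperquadratic_of`, the shared crux 0318 is thereby
closed MODULO the single load-bearing stub `stub_scaledPencilSuperquadratic` (= the asided route crux
`ScaledPencilSuperquadratic`, stmt-5318, open-problem grade). Honest framing: glue only; the superquadratic
lower bound `dc(per_n) ≥ n^{2+ε}` stays OPEN; nothing here bears on `VP ≠ VNP`.
-/

-- Sub = Summit layout duplicates the namespace component
set_option linter.dupNamespace false

namespace Summit.ValiantsHypothesis.ValiantsHypothesis.Theorems.DetQP.DetqpSuperquadratic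

open Summit.ValiantsHypothesis.ValiantsHypothesis
open Literature.Computability.AlgebraicComplexity

/-- **Gauge transfer** (stub `stub_gaugeTransfer` of line `scaled-pencil`, registered signature verbatim):
the normal form for minimal affine determinantal expressions of `per_n` (`ScaledPencil.NormalForm`)
turns a superquadratic size bound for NORMAL-FORM pencils (`ScaledPencil.ScaledPencilSuperquadratic`)
into the superquadratic bound `n^{2+ε} ≤ dc(per_n)` (`DetQP.DetqpSuperquadratic`). Proof: apply the
normal form to an expression of the attained size `dc(per_n)` and the gauge bound to the resulting
pencil of size `m' ≤ dc(per_n)`. -/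
theorem stub_gaugeTransfer :
    Theses.ScaledPencil.NormalForm → Theses.ScaledPencil.ScaledPencilSuperquadratic →
      Theses.DetQP.DetqpSuperquadratic := by
  intro hNF hSPS
  unfold Theses.DetQP.DetqpSuperquadratic
  unfold Theses.ScaledPencil.ScaledPencilSuperquadratic at hSPS
  unfold Theses.ScaledPencil.NormalForm at hNF
  obtain ⟨ε, hε, n₀, hn₀⟩ := hSPS
  refine ⟨ε, hε, n₀, fun n hn => ?_⟩
  -- an expression of the attained size `dc(per_n)`
  have hrep : HasDetRepr (perPoly (Fin n) ℂ) (determinantalComplexity (perPoly (Fin n) ℂ)) :=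
    hasDetRepr_determinantalComplexity_holds _
  -- its normal form, of size `m' ≤ dc(per_n)`
  obtain ⟨m', hm', Λ, L, hdet, hbal, hexp⟩ := hNF n _ hrep
  -- the gauge bound for the normal-form pencil
  have h := hn₀ n hn m' Λ L hdet hbal hexp
  exact h.trans (by exact_mod_cast hm')

end Summit.ValiantsHypothesis.ValiantsHypothesis.Theorems.DetQP.DetqpSuperquadratic
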